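/- Copyright: the b2b-balaban cell (near-miss cell 7), T⁴-continuum fan-out, row-NE7b OWNER lineage `t4-ne7b-p1` (gen 102) —
(α)-instance, THE END AT THE TOWER: the record's H2 ∕ dressing slots from ONE-STEP displays.  Released under the licence of the
surrounding project. -/
import Summits.QuantumFields.BalabanUV.T4Continuum.Support.B16HistoryTowerEndDataLWR

/-!
# (α)-INSTANCE — THE END AT THE TOWER: THE DRESSING SLOTS (`ρ₀ hρ₀ h0 B hB hBρ hBA intA H2A`) OF `TowerReadDataLWR` FROM ONE-STEP
DISPLAYS — the level-0 dressing `e^{t·obs}·ρ`, its sup letter, and `H2A` BY TELESCOPING per-step integral identities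

Summits-side support leaf of the T⁴-continuum cell (rung (B)+1 on a FINITE torus only; NOT infinite volume, NOT the mass gap, NOT
Clay; NOT a proof of NE7b — the cell's OWN estimate `T4WeightBudget.RelWeightBound`, NOT PRINTED, NOT PROVED).  [folklore] real
analysis and the tower's own telescoping lemma (`B16HistoryReprChain.Tower.integral_dens_eq_of_lt`, IR-97-2); no `Prop` minted, no
`structure`, nothing cited as hypothesis, zero `sorry`.

WHY.  After the J-chain (IR-97-2 … IR-101-1R) the rounded tower record `TowerReadDataLWR` (part 1R, p347096) still DISPLAYS, besides
print's per-step sentences, the K-STEP identity `H2A : ∫ e^{t·obs_K}·ρ^{(K)} dμ^{(K)}_0 = ∫ densFam T ρ₀ K t dμ_K` («the tower's final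
density IS the dressed density») together with the dressing's own slots `ρ₀`, `hρ₀`, `h0`, `B`, `hB`, `hBρ`, `hBA` and the integrability
display `intA`.  For a tower presented with ALL ITS LEVELS measured (`ν K j` on `X K j`, the END's `μ K` being `ν K K`) these are NOT
K-step readings: `H2A` TELESCOPES from (i) the level-0 dressing identity `H0` (the tower's level `0` IS the cutoff-`K` field with its
Wilson-action Gibbs density: `∫ e^{t·obs}·ρ dμ₀ = ∫ ρ₀ K t dν_{K,0}` — `rfl` ∕ a push-forward identity in the instance) and (ii) ONE
identity PER STEP AND CHOICE, `∫ (op j g p) f dν_{j+1} = ∫ χ_{j,g,p}·f dν_j` for good `f` (the shape of the normalisation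
`∫ dV 𝐓(ρ)(V) = ∫ dU ρ(U)` of the averaging operation, [Balaban1985AveragingOps] (0.4)-kind, composed with (0.4) of
[Balaban1989LargeFieldI] for 𝐑 — `SubstrateROperation.integral_rOfRecord` in the tree — LOCATORS ONLY, nothing asserted) with (iii) the
decomposition of unity of the step's characteristic functions `Σ_{p ∈ branch j g} χ_{j,g,p} ≡ 1` ([Balaban1989LargeFieldI] (1.3)–(1.9)
p. 178, LOCATOR); the dressing slots are ARITHMETIC of the two sup letters `|obs_K| ≤ Nο K` (for normalised loop products `≤ 1`,
`T4GenFunBounds.abs_prodObs_le_one`) and `0 ≤ ρ^{(K)} ≤ Dm K`; `intA` and the integrability displays of the telescoping are AUTOMATIC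
in the model class `bddMeas` under finite level measures (`B16HistoryReprChain.integrable_of_bddMeas` ∕ `intA_of_bddMeas`).

WHAT (all [folklore]; `T : (K : ℕ) → Tower P (X K) (𝒢 K)` an ABSTRACT tower, nothing of Bałaban's asserted).
§1 `dress obs d₀ K t y := exp (t·obs K y)·d₀ K y`; `dress_nonneg`; the sup letter `Bdress l₀ Nο Dm K t := exp (l₀·Nο K)·Dm K`,
   `Bdress_pos`, `abs_dress_le` (= the record's `hBρ`), `log_Bdress` ∕ `log_Bdress_le` (= the record's `hBA` from K-uniform letters),
   `dress_good` (generic class), `dress_bddMeas` (model class).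
§2 `H2A_of_levels` (= the record's `H2A` from `H0` + the TERMWISE per-step displays `hint ∕ hint' ∕ hpres` of `integral_dens_eq_of_lt`,
   asked on the window `|t| ≤ l₀`, `K₀ ≤ K` only); `hpres_of_stepIdentity` (the termwise `hpres` from the per-(step, choice) identity
   for GOOD functions + the decomposition of unity); `H2A_of_stepIdentity` (the two composed).
§3 The model class: `hint_bddMeas`, `hint'_bddMeas`, `hintχ_bddMeas` (the three integrability displays discharged when every level
   class is `bddMeas (X K j)` and every level measure is finite), `intA_bddMeas` (the record's `intA`), `H2A_bddMeas` (the record's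
   `H2A` from `H0` + step identity + decomposition of unity ALONE).
NET for a consumer of part 1R ∕ IR-101-2: the fields `ρ₀ := dress obs d₀`, `hρ₀ := dress_bddMeas …` (or `dress_good …`),
`h0 := dress_nonneg …`, `B := Bdress l₀ Nο Dm`, `hB := Bdress_pos …`, `hBρ := abs_dress_le …`, `hBA := log_Bdress_le …`,
`intA := intA_bddMeas …`, `H2A := H2A_bddMeas …` (or `H2A_of_stepIdentity …`) — what stays displayed of this group is `H0`, the
per-(step, choice) integral identity, the decomposition of unity, and four sup ∕ measurability letters.  HONEST LIMITS: nothing of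
Bałaban's is asserted or discharged; which tower is Bałaban's ((A1c)) is untouched; NE7b NOT proved; count 0∕9.  HONEST DEPENDENCY
(cell): continuum YM on T⁴ ⇐ BetaPertH ∧ nine spine estimates (0/9 proved); BetaPertH ⇐ (D1) ∧ (D4) ∧ CAP+tail; G-an2-4 gates asym,
D1 and NE2/3/4.  This file changes none of it.
-/

open Finset MeasureTheory
open Literature.MathematicalPhysics.QuantumFieldTheory.Balaban1983to89
open T4Continuum
open Summit.QuantumFields.BalabanUV.T4Continuum.B16HistoryIndexedRepr
open Summit.QuantumFields.BalabanUV.T4Continuum.B16HistoryReprChain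
open Summit.QuantumFields.BalabanUV.T4Continuum.B16HistoryReprInstance

namespace Summit.QuantumFields.BalabanUV.T4Continuum.B16HistoryTowerEndDressing

noncomputable section

/-! ## §1 The dressing of the level-0 density and its sup letter -/

section Dress

variable {X : ℕ → ℕ → Type}

/-- **THE DRESSED INITIAL DENSITY** of the cutoff-`K` tower at source value `t`: `ρ₀ K t y = e^{t·obs K y}·d₀ K y` (H2's dressing
of the level-0 density `d₀ K` by the loop observable `obs K`). [folklore] -/
def dress (obs d₀ : (K : ℕ) → X K 0 → ℝ) (K : ℕ) (t : ℝ) : X K 0 → ℝ :=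
  fun y => Real.exp (t * obs K y) * d₀ K y

/-- **THE SUP LETTER OF THE DRESSING**: `B K t := e^{l₀·Nο K}·Dm K` (source-blind). [folklore] -/
def Bdress (l₀ : ℝ) (Nο Dm : ℕ → ℝ) : ℕ → ℝ → ℝ :=
  fun K _ => Real.exp (l₀ * Nο K) * Dm K

variable {obs d₀ : (K : ℕ) → X K 0 → ℝ} {l₀ : ℝ} {Nο Dm : ℕ → ℝ}

/-- The dressed density is pointwise `e^{t·obs}·d₀`. [folklore] -/
theorem dress_apply (K : ℕ) (t : ℝ) (y : X K 0) : dress obs d₀ K t y = Real.exp (t * obs K y) * d₀ K y := rfl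

/-- The sup letter is `e^{l₀·Nο K}·Dm K`. [folklore] -/
theorem Bdress_apply (K : ℕ) (t : ℝ) : Bdress l₀ Nο Dm K t = Real.exp (l₀ * Nο K) * Dm K := rfl

/-- **THE RECORD's `h0`**: a non-negative level-0 density dresses to a non-negative density. [folklore] -/
theorem dress_nonneg (hd : ∀ K y, 0 ≤ d₀ K y) : ∀ (K : ℕ) (t : ℝ) (y : X K 0), 0 ≤ dress obs d₀ K t y :=
  fun K _ y => mul_nonneg (Real.exp_pos _).le (hd K y)

/-- **THE RECORD's `hB`**: the sup letter is positive when the density letter is. [folklore] -/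
theorem Bdress_pos (hD : ∀ K, 0 < Dm K) : ∀ (K : ℕ) (t : ℝ), 0 < Bdress l₀ Nο Dm K t :=
  fun K _ => mul_pos (Real.exp_pos _) (hD K)

/-- **THE RECORD's `hBρ`**: on the source window `|t| ≤ l₀` the dressed density is bounded by its letter, from the observable's sup
letter `|obs K| ≤ Nο K` and the density's `0 ≤ d₀ K ≤ Dm K` (the threshold `K₀` is idle here and kept for the slot's shape). [folklore] -/
theorem abs_dress_le {K₀ : ℕ} (hobs : ∀ K y, |obs K y| ≤ Nο K) (hd : ∀ K y, 0 ≤ d₀ K y) (hD : ∀ K y, d₀ K y ≤ Dm K) :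
    ∀ (K : ℕ) (t : ℝ), |t| ≤ l₀ → K₀ ≤ K → ∀ y : X K 0, |dress obs d₀ K t y| ≤ Bdress l₀ Nο Dm K t := by
  intro K t ht _ y
  rw [dress_apply, Bdress_apply, abs_mul, abs_of_nonneg (Real.exp_pos _).le, abs_of_nonneg (hd K y)]
  have h1 : t * obs K y ≤ l₀ * Nο K :=
    (le_abs_self _).trans (by
      rw [abs_mul]
      exact mul_le_mul ht (hobs K y) (abs_nonneg _) ((abs_nonneg t).trans ht))
  exact mul_le_mul (Real.exp_le_exp.2 h1) (hD K y) (hd K y) (Real.exp_pos _).le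

/-- The letter's logarithm: `log (B K t) = l₀·Nο K + log (Dm K)`. [folklore] -/
theorem log_Bdress (hD : ∀ K, 0 < Dm K) (K : ℕ) (t : ℝ) :
    Real.log (Bdress l₀ Nο Dm K t) = l₀ * Nο K + Real.log (Dm K) := by
  rw [Bdress_apply, Real.log_mul (Real.exp_pos _).ne' (hD K).ne', Real.log_exp]

/-- **THE RECORD's `hBA`**: K-uniform letters `Nο K ≤ Nοi`, `log (Dm K) ≤ LDi` (with `0 ≤ l₀`) give the K-uniform bound
`log (B K t) ≤ l₀·Nοi + LDi` (the END's `BAi`). [folklore] -/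
theorem log_Bdress_le {K₀ : ℕ} {Nοi LDi : ℝ} (hD : ∀ K, 0 < Dm K) (hl₀ : 0 ≤ l₀) (hN : ∀ K, Nο K ≤ Nοi)
    (hLD : ∀ K, Real.log (Dm K) ≤ LDi) :
    ∀ (K : ℕ) (t : ℝ), |t| ≤ l₀ → K₀ ≤ K → Real.log (Bdress l₀ Nο Dm K t) ≤ l₀ * Nοi + LDi := by
  intro K t _ _
  rw [log_Bdress hD]
  exact add_le_add (mul_le_mul_of_nonneg_left (hN K) hl₀) (hLD K)

/-- **THE RECORD's `hρ₀`, GENERIC CLASS**: if the class of level `0` contains the exponentials `e^{t·obs K}` and the density `d₀ K`, it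
contains the dressed density. [folklore] -/
theorem dress_good {𝒢 : (K j : ℕ) → GoodClass (X K j)} (hexp : ∀ K t, (𝒢 K 0).Gd fun y => Real.exp (t * obs K y))
    (hd : ∀ K, (𝒢 K 0).Gd (d₀ K)) : ∀ (K : ℕ) (t : ℝ), (𝒢 K 0).Gd (dress obs d₀ K t) :=
  fun K t => (𝒢 K 0).mul (hexp K t) (hd K)

/-- **THE RECORD's `hρ₀`, MODEL CLASS**: measurable `obs K`, `d₀ K` with the two sup letters dress to a BOUNDED MEASURABLE density.
[folklore] -/
theorem dress_bddMeas [∀ K j, MeasurableSpace (X K j)] (hom : ∀ K, Measurable (obs K)) (hobs : ∀ K y, |obs K y| ≤ Nο K)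
    (hdm : ∀ K, Measurable (d₀ K)) (hd : ∀ K y, 0 ≤ d₀ K y) (hD : ∀ K y, d₀ K y ≤ Dm K) :
    ∀ (K : ℕ) (t : ℝ), (bddMeas (X K 0)).Gd (dress obs d₀ K t) := by
  intro K t
  refine ⟨((hom K).const_mul t).exp.mul (hdm K), Bdress |t| Nο Dm K t, fun y => ?_⟩
  exact abs_dress_le (K₀ := 0) (l₀ := |t|) hobs hd hD K t le_rfl (Nat.zero_le _) y

end Dress

/-! ## §2 `H2A` by telescoping the per-step integral identities -/

section Telescope

variable {F : T4Family} {G : Type*} [GaugeGroup G] [MeasurableSpace G] [HaarData G]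
  (D : FiniteEpsData F G) (g₀ : ℕ → ℝ) (os : List (ULoop F))
  {P : Type} {X : ℕ → ℕ → Type} {𝒢 : (K j : ℕ) → GoodClass (X K j)}
  (T : (K : ℕ) → Tower P (X K) (𝒢 K)) (ρ₀ : (K : ℕ) → ℝ → X K 0 → ℝ)
  [∀ K j, MeasurableSpace (X K j)] (ν : (K j : ℕ) → Measure (X K j)) {l₀ : ℝ} {K₀ : ℕ}

/-- **THE RECORD's `H2A` BY TELESCOPING** (`μ K := ν K K`): the level-0 dressing identity `H0` and the TERMWISE per-step displays of
`Tower.integral_dens_eq_of_lt` — integrability of every history term and of its one-step images, and preservation of every history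
term's integral by the sum over the admissible next choices — at the levels `j < K`, on the window `|t| ≤ l₀`, `K₀ ≤ K`, give
`∫ e^{t·obs}·ρ dμ₀ = ∫ densFam T ρ₀ K t dν_{K,K}`. [folklore] -/
theorem H2A_of_levels
    (H0 : ∀ K t, |t| ≤ l₀ → K₀ ≤ K →
      ∫ U, Real.exp (t * T4GenFunBounds.prodObs (D.scheme g₀) K os U) * D.dens K (g₀ K) 0 U ∂fieldMeasure (F.P K) 0 G =
        ∫ y, ρ₀ K t y ∂ν K 0)
    (hint : ∀ K t, |t| ≤ l₀ → K₀ ≤ K → ∀ j g, j < K → g ∈ (T K).adm j → Integrable ((T K).eterm (ρ₀ K t) j g) (ν K j))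
    (hint' : ∀ K t, |t| ≤ l₀ → K₀ ≤ K → ∀ j g p, j < K → g ∈ (T K).adm j → p ∈ (T K).branch j g →
      Integrable (((T K).op j g p).T ((T K).eterm (ρ₀ K t) j g)) (ν K (j + 1)))
    (hpres : ∀ K t, |t| ≤ l₀ → K₀ ≤ K → ∀ j g, j < K → g ∈ (T K).adm j →
      ∫ x, (∑ p ∈ (T K).branch j g, ((T K).op j g p).T ((T K).eterm (ρ₀ K t) j g) x) ∂ν K (j + 1) =
        ∫ x, (T K).eterm (ρ₀ K t) j g x ∂ν K j) :
    ∀ K t, |t| ≤ l₀ → K₀ ≤ K →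
      ∫ U, Real.exp (t * T4GenFunBounds.prodObs (D.scheme g₀) K os U) * D.dens K (g₀ K) 0 U ∂fieldMeasure (F.P K) 0 G =
        ∫ x, densFam T ρ₀ K t x ∂ν K K := by
  intro K t ht hK
  rw [H0 K t ht hK]
  exact ((T K).integral_dens_eq_of_lt (ν K) (ρ₀ K t) K (hint K t ht hK) (hint' K t ht hK) (hpres K t ht hK)).symm

variable (χ : (K j : ℕ) → (Fin j → P) → P → X K j → ℝ)

/-- **THE TERMWISE PRESERVATION FROM THE PER-(STEP, CHOICE) IDENTITY AND THE DECOMPOSITION OF UNITY**: if for every admissible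
history `g` of a level `j < K` and every admissible next choice `p` the step map carries the integral identity
`∫ (op j g p) f dν_{j+1} = ∫ χ_{j,g,p}·f dν_j` FOR GOOD `f` (display `hstep`), the step's characteristic functions sum to one over the
admissible choices (display `hunit`), the dressed density is good (so every history term is), and the one-step images and the
`χ`-weighted terms are integrable (displays `hint'`, `hintχ`), then the sum over the next choices preserves every history term's
integral (`hpres` of `H2A_of_levels`). [folklore] -/
theorem hpres_of_stepIdentity (hρ : ∀ K t, (𝒢 K 0).Gd (ρ₀ K t))
    (hstep : ∀ K, K₀ ≤ K → ∀ j g p, j < K → g ∈ (T K).adm j → p ∈ (T K).branch j g →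
      ∀ f : X K j → ℝ, (𝒢 K j).Gd f → ∫ x, ((T K).op j g p).T f x ∂ν K (j + 1) = ∫ y, χ K j g p y * f y ∂ν K j)
    (hunit : ∀ K, K₀ ≤ K → ∀ j g, j < K → g ∈ (T K).adm j → ∀ y, ∑ p ∈ (T K).branch j g, χ K j g p y = 1)
    (hint' : ∀ K t, |t| ≤ l₀ → K₀ ≤ K → ∀ j g p, j < K → g ∈ (T K).adm j → p ∈ (T K).branch j g →
      Integrable (((T K).op j g p).T ((T K).eterm (ρ₀ K t) j g)) (ν K (j + 1)))
    (hintχ : ∀ K t, |t| ≤ l₀ → K₀ ≤ K → ∀ j g p, j < K → g ∈ (T K).adm j → p ∈ (T K).branch j g →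
      Integrable (fun y => χ K j g p y * (T K).eterm (ρ₀ K t) j g y) (ν K j)) :
    ∀ K t, |t| ≤ l₀ → K₀ ≤ K → ∀ j g, j < K → g ∈ (T K).adm j →
      ∫ x, (∑ p ∈ (T K).branch j g, ((T K).op j g p).T ((T K).eterm (ρ₀ K t) j g) x) ∂ν K (j + 1) =
        ∫ x, (T K).eterm (ρ₀ K t) j g x ∂ν K j := by
  intro K t ht hK j g hj hg
  rw [integral_finsetSum _ fun p hp => hint' K t ht hK j g p hj hg hp]
  rw [Finset.sum_congr rfl fun p hp => hstep K hK j g p hj hg hp _ ((T K).eterm_good (hρ K t) j g)]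
  rw [← integral_finsetSum _ fun p hp => hintχ K t ht hK j g p hj hg hp]
  refine integral_congr_ae (Filter.Eventually.of_forall fun y => ?_)
  show ∑ p ∈ (T K).branch j g, χ K j g p y * (T K).eterm (ρ₀ K t) j g y = (T K).eterm (ρ₀ K t) j g y
  rw [← Finset.sum_mul, hunit K hK j g hj hg y, one_mul]

/-- **THE RECORD's `H2A` FROM `H0`, THE PER-(STEP, CHOICE) IDENTITY AND THE DECOMPOSITION OF UNITY** (with the three integrability
displays): `H2A_of_levels` ∘ `hpres_of_stepIdentity`. [folklore] -/
theorem H2A_of_stepIdentity (hρ : ∀ K t, (𝒢 K 0).Gd (ρ₀ K t))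
    (H0 : ∀ K t, |t| ≤ l₀ → K₀ ≤ K →
      ∫ U, Real.exp (t * T4GenFunBounds.prodObs (D.scheme g₀) K os U) * D.dens K (g₀ K) 0 U ∂fieldMeasure (F.P K) 0 G =
        ∫ y, ρ₀ K t y ∂ν K 0)
    (hstep : ∀ K, K₀ ≤ K → ∀ j g p, j < K → g ∈ (T K).adm j → p ∈ (T K).branch j g →
      ∀ f : X K j → ℝ, (𝒢 K j).Gd f → ∫ x, ((T K).op j g p).T f x ∂ν K (j + 1) = ∫ y, χ K j g p y * f y ∂ν K j)
    (hunit : ∀ K, K₀ ≤ K → ∀ j g, j < K → g ∈ (T K).adm j → ∀ y, ∑ p ∈ (T K).branch j g, χ K j g p y = 1)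
    (hint : ∀ K t, |t| ≤ l₀ → K₀ ≤ K → ∀ j g, j < K → g ∈ (T K).adm j → Integrable ((T K).eterm (ρ₀ K t) j g) (ν K j))
    (hint' : ∀ K t, |t| ≤ l₀ → K₀ ≤ K → ∀ j g p, j < K → g ∈ (T K).adm j → p ∈ (T K).branch j g →
      Integrable (((T K).op j g p).T ((T K).eterm (ρ₀ K t) j g)) (ν K (j + 1)))
    (hintχ : ∀ K t, |t| ≤ l₀ → K₀ ≤ K → ∀ j g p, j < K → g ∈ (T K).adm j → p ∈ (T K).branch j g →
      Integrable (fun y => χ K j g p y * (T K).eterm (ρ₀ K t) j g y) (ν K j)) :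
    ∀ K t, |t| ≤ l₀ → K₀ ≤ K →
      ∫ U, Real.exp (t * T4GenFunBounds.prodObs (D.scheme g₀) K os U) * D.dens K (g₀ K) 0 U ∂fieldMeasure (F.P K) 0 G =
        ∫ x, densFam T ρ₀ K t x ∂ν K K :=
  H2A_of_levels D g₀ os T ρ₀ ν H0 hint hint' (hpres_of_stepIdentity T ρ₀ ν χ hρ hstep hunit hint' hintχ)

end Telescope

/-! ## §3 The model class: bounded measurable functions at every level, finite level measures -/

section Model

variable {F : T4Family} {G : Type*} [GaugeGroup G] [MeasurableSpace G] [HaarData G]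
  (D : FiniteEpsData F G) (g₀ : ℕ → ℝ) (os : List (ULoop F))
  {P : Type} {X : ℕ → ℕ → Type} [∀ K j, MeasurableSpace (X K j)]
  (T : (K : ℕ) → Tower P (X K) (fun j => bddMeas (X K j))) (ρ₀ : (K : ℕ) → ℝ → X K 0 → ℝ)
  (ν : (K j : ℕ) → Measure (X K j)) [∀ K j, IsFiniteMeasure (ν K j)] {l₀ : ℝ} {K₀ : ℕ}

/-- In the model class every history term of a good dressed density is integrable (display `hint` discharged). [folklore] -/
theorem hint_bddMeas (hρ : ∀ K t, (bddMeas (X K 0)).Gd (ρ₀ K t)) :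
    ∀ K t, |t| ≤ l₀ → K₀ ≤ K → ∀ (j : ℕ) (g : Fin j → P), j < K → g ∈ (T K).adm j →
      Integrable ((T K).eterm (ρ₀ K t) j g) (ν K j) :=
  fun K t _ _ j g _ _ => integrable_of_bddMeas (ν K j) ((T K).eterm_good (hρ K t) j g)

/-- … and so is every one-step image of a history term (display `hint'` discharged). [folklore] -/
theorem hint'_bddMeas (hρ : ∀ K t, (bddMeas (X K 0)).Gd (ρ₀ K t)) :
    ∀ K t, |t| ≤ l₀ → K₀ ≤ K → ∀ (j : ℕ) (g : Fin j → P) (p : P), j < K → g ∈ (T K).adm j → p ∈ (T K).branch j g →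
      Integrable (((T K).op j g p).T ((T K).eterm (ρ₀ K t) j g)) (ν K (j + 1)) :=
  fun K t _ _ j g p _ _ _ => integrable_of_bddMeas (ν K (j + 1)) (((T K).op j g p).map_good ((T K).eterm_good (hρ K t) j g))

/-- … and every `χ`-weighted history term, for good characteristic functions (display `hintχ` discharged). [folklore] -/
theorem hintχ_bddMeas (hρ : ∀ K t, (bddMeas (X K 0)).Gd (ρ₀ K t)) (χ : (K j : ℕ) → (Fin j → P) → P → X K j → ℝ)
    (hχ : ∀ K j g p, (bddMeas (X K j)).Gd (χ K j g p)) :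
    ∀ K t, |t| ≤ l₀ → K₀ ≤ K → ∀ (j : ℕ) (g : Fin j → P) (p : P), j < K → g ∈ (T K).adm j → p ∈ (T K).branch j g →
      Integrable (fun y => χ K j g p y * (T K).eterm (ρ₀ K t) j g y) (ν K j) :=
  fun K t _ _ j g p _ _ _ =>
    integrable_of_bddMeas (ν K j) ((bddMeas (X K j)).mul (hχ K j g p) ((T K).eterm_good (hρ K t) j g))

/-- **THE RECORD's `intA` IN THE MODEL CLASS** (`μ K := ν K K`): every elementary term of the tower's operations `reprFam` is integrable.
[folklore] -/
theorem intA_bddMeas [DecidableEq P] (p₀ : ℕ → ℕ → P) (hρ : ∀ K t, (bddMeas (X K 0)).Gd (ρ₀ K t))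
    (h0 : ∀ K t x, 0 ≤ ρ₀ K t x) (B : ℕ → ℝ → ℝ) (hB : ∀ K t, 0 < B K t) :
    ∀ (K : ℕ) (t : ℝ) (a : (skelFam T p₀ K).Adm), ∀ ι ∈ (skelFam T p₀ K).LIdx a,
      Integrable ((reprFam T p₀ ρ₀ hρ h0 B hB K t).eterm a ι) (ν K K) :=
  fun K t a ι _ => intA_of_bddMeas (ν K K) (reprFam T p₀ ρ₀ hρ h0 B hB K t) a ι

/-- **THE RECORD's `H2A` IN THE MODEL CLASS FROM `H0`, THE PER-(STEP, CHOICE) IDENTITY AND THE DECOMPOSITION OF UNITY ALONE** (good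
characteristic functions; the three integrability displays discharged by the class). [folklore] -/
theorem H2A_bddMeas (hρ : ∀ K t, (bddMeas (X K 0)).Gd (ρ₀ K t)) (χ : (K j : ℕ) → (Fin j → P) → P → X K j → ℝ)
    (hχ : ∀ K j g p, (bddMeas (X K j)).Gd (χ K j g p))
    (H0 : ∀ K t, |t| ≤ l₀ → K₀ ≤ K →
      ∫ U, Real.exp (t * T4GenFunBounds.prodObs (D.scheme g₀) K os U) * D.dens K (g₀ K) 0 U ∂fieldMeasure (F.P K) 0 G =
        ∫ y, ρ₀ K t y ∂ν K 0)
    (hstep : ∀ K, K₀ ≤ K → ∀ j g p, j < K → g ∈ (T K).adm j → p ∈ (T K).branch j g →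
      ∀ f : X K j → ℝ, (bddMeas (X K j)).Gd f →
        ∫ x, ((T K).op j g p).T f x ∂ν K (j + 1) = ∫ y, χ K j g p y * f y ∂ν K j)
    (hunit : ∀ K, K₀ ≤ K → ∀ j g, j < K → g ∈ (T K).adm j → ∀ y, ∑ p ∈ (T K).branch j g, χ K j g p y = 1) :
    ∀ K t, |t| ≤ l₀ → K₀ ≤ K →
      ∫ U, Real.exp (t * T4GenFunBounds.prodObs (D.scheme g₀) K os U) * D.dens K (g₀ K) 0 U ∂fieldMeasure (F.P K) 0 G =
        ∫ x, densFam T ρ₀ K t x ∂ν K K :=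
  H2A_of_stepIdentity D g₀ os T ρ₀ ν χ hρ H0 hstep hunit (hint_bddMeas T ρ₀ ν hρ) (hint'_bddMeas T ρ₀ ν hρ)
    (hintχ_bddMeas T ρ₀ ν hρ χ hχ)

end Model

end

end Summit.QuantumFields.BalabanUV.T4Continuum.B16HistoryTowerEndDressing
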